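import Literature.IUT.HodgeTheaters.KitEvalBinderGroupoidObstruction
import Literature.IUT.HodgeTheaters.KitCoreBridge
import Literature.IUT.HodgeTheaters.PiAvatarBaseKitNFInstances
import Literature.GroupTheory.ProfiniteConjugateIndex
import HarnessLib

/-!
# [IUTchI] Prop 6.7 / Ex 4.4 at the GENUINE Π-avatar kits: NO §4 ↔ §6 core agreement `KitCore` and NO evaluation-section
# binder `EvalBinder` over the EMBEDDED ambient (design D1) — a kernel OBSTRUCTION for law (γ) `KitCore.ThetaAgrees`
# at the D13 instance (node IUTchI:Prop6.7; proof-only, no definition, no new `Prop` fact)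

S. Mochizuki, *Inter-universal Teichmüller theory I*, kurims manuscript (May 2020), Example 4.4 (i) pp. 106–107 («the
poly-morphism … obtained by composing the natural morphism `ℬ^temp(Π_v̲)⁰ → ℬ^temp(G_v̲)⁰` [induced by `Π_v̲ ↠ G_v̲`] with the
evaluation section `G_v̲ → Π_v̲` labeled `j`»), (ii) p. 107 («composing with arbitrary isomorphisms»), Proposition 6.7 p. 167
(«replacing the `+`-full poly-morphisms … at the `v ∈ 𝕍^bad` by the poly-morphisms described [via group-theoretic algorithms!]
in Example 4.4, (i), (ii)»), Definition 4.1 (i) p. 95, Definition 6.1 (i)(ii) p. 156, §0 «Categories» p. 33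
([IUTchI] Prop 6.7 p.167) [claim: Mochizuki2012, status: disputed] (D-0012 claim key, series status DISPUTED — kernel theorems
about abc-iut's OWN hypothesis structures and kit constructions; nothing of the series is asserted and no side is taken on
[IUTchIII] Cor. 3.12).

## What this file proves (DAG node IUTchI:Prop6.7, NODE RULE #17 law (γ); junction J-Θ-1 of abc-iut-L5-t3 g6)

abc-iut-L5-t4's statement `DThetaPMBridge.ThetaBridgeAlgorithm M P hl` of Prop 6.7 is PROVED at the interface in two readings
(`thetaBridgeAlgorithm_isModelConjugate` (hbad), abc-iut-w4-d054 p412223; `KitCore.thetaBridgeAlgorithm_dThetaBridge`,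
abc-iut-L5-t3 p417112), the §4 reading being conditional on a CORE AGREEMENT `c : 𝔡.KitCore K` of the §6 kit with a §4 datum
and on the law (γ) `c.ThetaAgrees M`.  The L5 programme (D13) asks for (γ) as a THEOREM at the GENUINE kit built from the real
`InitialThetaData` (abc-iut-L5-t4 `baseKitOfData`/`baseKit`/`baseKitOfTorsionMonodromy`/`baseKitStandIn`/`baseKitOfBadPairs`,
abc-iut-L5-t4/t3 `baseKitNFOfData`/`baseKitNF`/`baseKitNFOfBadPairs`/`baseKitNFStandIn`), whose ambient at every index is a full
subcategory of the ORBIT CATEGORY `OrbitCat Π_{C_F}` of ONE profinite group (design D1 = EMBEDDED): `Hom(ℬ(H)⁰, ℬ(H')⁰)` = the coset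
maps `xH ↦ xaH'` with `a⁻¹Ha ≤ H'` (`OrbitCat.exists_eq_homOfElem`).  We prove:

* `BaseThetaDatum.exists_endo_not_isIso` — in ANY §4 datum, at a bad place every isomorph of `𝒟_v` has a NON-invertible
  endomorphism (labels `0 ≠ [1]` both occur on `End(X)`, Ex 4.4 (i); iso-closure, Ex 4.4 (ii); label well defined, Ex 4.4 (iv));
* `BaseThetaDatum.KitCore.exists_endo_not_isIso` / `isEmpty_kitCore_of_forall_isIso` — hence a core agreement `KitCore 𝔡 K` forces a
  non-invertible endomorphism of the kit's model `𝒟_v` at every bad index (fully faithful comparison functors reflect isomorphisms):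
  NO `KitCore` exists over a kit whose bad-place model has only invertible endomorphisms (the `KitCore` twin of
  `EvalBinder.false_of_forall_isIso`, abc-iut p433311);
* `OrbitCat.isIso_homOfElem_iff` — in the orbit category an endomorphism `xH ↦ xaH` (`a⁻¹Ha ≤ H`) of `ℬ(H)⁰` is an isomorphism
  iff `a ∈ N(H)`; so ALL endomorphisms of `ℬ(H)⁰` are automorphisms as soon as `H` is not conjugate to a PROPER subgroup of itself
  (`OrbitCat.isIso_of_conj_le_imp_mem_normalizer`), which holds for every CLOSED subgroup of a profinite group
  (`OrbitCat.mem_normalizer_of_conj_le_of_isClosed`, from `Literature.GroupTheory.ProfiniteConjugateIndex.mem_normalizer_of_conj_mem`);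
* at the genuine kits: `InitialThetaData.exists_conj_lt_of_evalBinder_baseKitOfData` / `…_of_kitCore_…` — an `EvalBinder` or a
  `KitCore` over `baseKitOfData … δ` (resp. `baseKitNFOfData … δ`) forces, at every bad index `v`, an element `a ∈ Π_{C_F}` with
  `a⁻¹ Π_v̲ a ≤ Π_v̲` and `a ∉ N(Π_v̲)` (`Π_v̲ = (δ v).H` conjugate STRICTLY into itself); contrapositively
  `isEmpty_evalBinder_baseKitOfData_of_isClosed` / `isEmpty_kitCore_baseKitOfData_of_isClosed` (and the `NF`, `OfBadPairs`, `StandIn`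
  corollaries): if ONE bad-index local group is closed in `Π_{C_F}`, the kit carries NO `EvalBinder` and NO `KitCore` with ANY §4 datum —
  in particular the binder `E : EvalBinder` of abc-iut-L5-t3's `kitCoreStandIn E` / `thetaAgrees_standIn` (p452433) is then uninhabited,
  and law (γ) cannot be instantiated at the D13 kits as designed.

READING (no side taken): print's `φ^Θ_{v̲_j}` at `v̲ ∈ 𝕍^bad` is induced by the NON-injective continuous homomorphism
`Π_v̲ ↠ G_v̲ → Π_v̲`; such outer homomorphisms are morphisms of connected temperoids (§0) but are NOT morphisms «over `Π_{C_F}`» of the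
embedded orbit category.  The obstruction is about OUR kit design (D1 EMBEDDED), not about print: hosting Ex 4.4 / Prop 6.7 at the
genuine data needs a bad-place ambient whose morphisms include these outer homomorphisms (GAP-LEDGER row G-w4d054g7-1).
typed ≠ inhabited ≠ discharged; binder ≠ fact.
-/

namespace Literature.IUT.HodgeTheaters

open CategoryTheory

universe u v w

/-! ### §1. Any §4 datum: a non-invertible endomorphism at every bad place -/

namespace BaseThetaDatum

/-- **Ex 4.4 (i)(ii)(iv) force a NON-invertible endomorphism of every isomorph of `𝒟_v` at a bad place.**  The evaluation
sections of labels `0` and `[1]` on `End(X)` (every label occurs) would, if both invertible, differ by an automorphism, so the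
label-`0` class would contain the label-`[1]` section (closure under composition with isomorphisms) — contradicting the
well-definedness of labels (`[1] ≠ 0` in `|𝔽_l|`). ([IUTchI] Ex 4.4 (i) p.106) [claim: Mochizuki2012, status: disputed] -/
theorem exists_endo_not_isIso (𝔡 : BaseThetaDatum.{u}) {v : 𝔡.V} (hv : 𝔡.IsBad v) (X : 𝔡.Amb v) :
    ∃ f : X ⟶ X, ¬ IsIso f := by
  by_contra hall
  simp only [not_exists, not_not] at hall
  have hne : FlStar.toFlAbs 𝔡.l (FlStar.mk 𝔡.l 1) ≠ FlAbs.zero 𝔡.l := FlStar.toFlAbs_ne_zero 𝔡.l _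
  obtain ⟨f₀, hf₀⟩ := 𝔡.exists_isEvalSection hv (FlAbs.zero 𝔡.l) X X
  obtain ⟨f₁, hf₁⟩ := 𝔡.exists_isEvalSection hv (FlStar.toFlAbs 𝔡.l (FlStar.mk 𝔡.l 1)) X X
  haveI := hall f₀
  haveI := hall f₁
  have h : 𝔡.IsEvalSection hv (FlAbs.zero 𝔡.l) ((asIso (f₁ ≫ inv f₀)).hom ≫ f₀) :=
    𝔡.isEvalSection_isoComp hv _ (asIso (f₁ ≫ inv f₀)) f₀ hf₀
  rw [asIso_hom, Category.assoc, IsIso.inv_hom_id, Category.comp_id] at h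
  exact hne (𝔡.isEvalSection_label_unique hv f₁ hf₁ h)

namespace KitCore

variable {𝔡 : BaseThetaDatum.{u}} {K : PMBaseKit.{u} 𝔡.l}

/-- **A core agreement forces a NON-invertible endomorphism of the kit's model at every bad index.**  Transport a non-invertible
endomorphism of `𝒟_v` (previous lemma) along the fully faithful comparison functor and the model identification; fully faithful
functors reflect isomorphisms. ([IUTchI] Def 6.1 (i) p.156) [claim: Mochizuki2012, status: disputed] -/
theorem exists_endo_not_isIso (c : 𝔡.KitCore K) {x : K.V} (hx : x ∈ K.bad) :
    ∃ g : K.model x ⟶ K.model x, ¬ IsIso g := by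
  obtain ⟨f, hf⟩ := 𝔡.exists_endo_not_isIso (c.isBad_e hx) (𝔡.D (c.e x))
  refine ⟨(c.ambModel x).inv ≫ (c.amb x).map f ≫ (c.ambModel x).hom, fun hg => hf ?_⟩
  haveI : IsIso ((c.amb x).map f) := by
    have h : (c.amb x).map f =
        (c.ambModel x).hom ≫ ((c.ambModel x).inv ≫ (c.amb x).map f ≫ (c.ambModel x).hom) ≫ (c.ambModel x).inv := by
      simp
    rw [h]
    infer_instance
  exact (c.ambFF x).isIso_of_isIso_map f

/-- **No core agreement over a bad model all of whose endomorphisms are invertible.** ([IUTchI] Def 6.1 (i) p.156) [claim: Mochizuki2012, status: disputed] -/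
theorem false_of_forall_isIso (c : 𝔡.KitCore K) {x : K.V} (hx : x ∈ K.bad)
    (hiso : ∀ g : K.model x ⟶ K.model x, IsIso g) : False := by
  obtain ⟨g, hg⟩ := c.exists_endo_not_isIso hx
  exact hg (hiso g)

end KitCore

/-- Contrapositive packaging: a kit with a bad index whose model has only invertible endomorphisms carries NO `KitCore` with
ANY §4 datum (of the kit's `l`). ([IUTchI] Def 6.1 (i) p.156) [claim: Mochizuki2012, status: disputed] -/
theorem isEmpty_kitCore_of_forall_isIso (𝔡 : BaseThetaDatum.{u}) (K : PMBaseKit.{u} 𝔡.l) {x : K.V} (hx : x ∈ K.bad)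
    (hiso : ∀ g : K.model x ⟶ K.model x, IsIso g) : IsEmpty (𝔡.KitCore K) :=
  ⟨fun c => c.false_of_forall_isIso hx hiso⟩

end BaseThetaDatum

/-! ### §2. The orbit category: endomorphisms of `ℬ(H)⁰` are automorphisms iff the conjugator normalises `H` -/

namespace OrbitCat

variable {A : Type u} [Group A]

/-- `xH ↦ xaH` is an isomorphism when `a` normalises `H` (it is `autOfNormalizer a`). ([IUTchI] Def 6.1 (v) p.158) [claim: Mochizuki2012, status: disputed] -/
theorem isIso_homOfElem_of_mem_normalizer {H : Subgroup A} (a : A) (h : ∀ x ∈ H, a⁻¹ * x * a ∈ H)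
    (ha : a ∈ Subgroup.normalizer (H : Set A)) : IsIso (homOfElem a h : (of H : OrbitCat A) ⟶ of H) :=
  (autOfNormalizer a ha).isIso_hom

/-- Conversely an invertible `xH ↦ xaH` has `a ∈ N(H)`: if `xH ↦ xbH` is the inverse then `ab ∈ H` (evaluate `hom ≫ inv = 𝟙` at `H`)
and `aHa⁻¹ = (ab)(b⁻¹Hb)(ab)⁻¹ ≤ H`. ([IUTchI] Def 6.1 (v) p.158) [claim: Mochizuki2012, status: disputed] -/
theorem mem_normalizer_of_isIso_homOfElem {H : Subgroup A} (a : A) (h : ∀ x ∈ H, a⁻¹ * x * a ∈ H)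
    (hiso : IsIso (homOfElem a h : (of H : OrbitCat A) ⟶ of H)) : a ∈ Subgroup.normalizer (H : Set A) := by
  obtain ⟨b, hb, heb⟩ := exists_eq_homOfElem (inv (homOfElem a h : (of H : OrbitCat A) ⟶ of H))
  have hab : a * b ∈ H := by
    have h1 := congrArg (fun φ => fn φ (QuotientGroup.mk (1 : A))) (IsIso.hom_inv_id (homOfElem a h : (of H : OrbitCat A) ⟶ of H))
    simp only [fn_comp, Function.comp_apply, fn_id, id_eq, heb, fn_homOfElem, one_mul] at h1
    have h2 := QuotientGroup.eq.mp h1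
    simpa using H.inv_mem h2
  rw [Subgroup.mem_normalizer_iff]
  intro x
  constructor
  · intro hx
    have h3 := hb x hx
    have h4 : a * x * a⁻¹ = (a * b) * (b⁻¹ * x * b) * (a * b)⁻¹ := by group
    rw [h4]
    exact H.mul_mem (H.mul_mem hab h3) (H.inv_mem hab)
  · intro hx
    have h5 := h _ hx
    simpa [mul_assoc] using h5

/-- **`End(ℬ(H)⁰)` versus `Aut(ℬ(H)⁰)`**: `xH ↦ xaH` (`a⁻¹Ha ≤ H`) is an isomorphism iff `a ∈ N(H)`. ([IUTchI] Def 6.1 (v) p.158) [claim: Mochizuki2012, status: disputed] -/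
theorem isIso_homOfElem_iff {H : Subgroup A} (a : A) (h : ∀ x ∈ H, a⁻¹ * x * a ∈ H) :
    IsIso (homOfElem a h : (of H : OrbitCat A) ⟶ of H) ↔ a ∈ Subgroup.normalizer (H : Set A) :=
  ⟨mem_normalizer_of_isIso_homOfElem a h, isIso_homOfElem_of_mem_normalizer a h⟩

/-- **All endomorphisms of `ℬ(H)⁰` are automorphisms when `H` is not conjugate to a proper subgroup of itself**
(`a⁻¹Ha ≤ H ⇒ a ∈ N(H)`). ([IUTchI] Def 4.1 (i) p.95) [claim: Mochizuki2012, status: disputed] -/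
theorem isIso_of_conj_le_imp_mem_normalizer {H : Subgroup A}
    (hN : ∀ a : A, (∀ x ∈ H, a⁻¹ * x * a ∈ H) → a ∈ Subgroup.normalizer (H : Set A))
    (f : (of H : OrbitCat A) ⟶ of H) : IsIso f := by
  obtain ⟨a, h, rfl⟩ := exists_eq_homOfElem f
  exact isIso_homOfElem_of_mem_normalizer a h (hN a h)

/-- Conversely a NON-invertible endomorphism of `ℬ(H)⁰` exhibits `H` conjugate STRICTLY into itself. ([IUTchI] Def 4.1 (i) p.95) [claim: Mochizuki2012, status: disputed] -/
theorem exists_conj_lt_of_not_isIso {H : Subgroup A} (f : (of H : OrbitCat A) ⟶ of H) (hf : ¬ IsIso f) :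
    ∃ a : A, (∀ x ∈ H, a⁻¹ * x * a ∈ H) ∧ a ∉ Subgroup.normalizer (H : Set A) := by
  obtain ⟨a, h, rfl⟩ := exists_eq_homOfElem f
  exact ⟨a, h, fun ha => hf (isIso_homOfElem_of_mem_normalizer a h ha)⟩

/-- **Closed subgroups of profinite groups are never conjugate to a proper subgroup of themselves**: `a⁻¹Ha ≤ H ⇒ a ∈ N(H)`
(count images in the finite quotients; `Literature.GroupTheory.ProfiniteConjugateIndex.mem_normalizer_of_conj_mem`, read for `a⁻¹`).
[cite: HoshiMochizukiCbTpII2022, Lemma 3.9 (iv) (proof, last step)] -/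
theorem mem_normalizer_of_conj_le_of_isClosed [TopologicalSpace A] [IsTopologicalGroup A] [CompactSpace A]
    [TotallyDisconnectedSpace A] {H : Subgroup A} (hH : IsClosed (H : Set A)) (a : A) (h : ∀ x ∈ H, a⁻¹ * x * a ∈ H) :
    a ∈ Subgroup.normalizer (H : Set A) := by
  have h' : a⁻¹ ∈ Subgroup.normalizer (H : Set A) :=
    Literature.GroupTheory.ProfiniteConjugateIndex.mem_normalizer_of_conj_mem H hH a⁻¹ (fun c hc => by simpa using h c hc)
  simpa using (Subgroup.normalizer (H : Set A)).inv_mem h'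

/-- Hence over a profinite group every endomorphism of `ℬ(H)⁰`, `H` closed, is an automorphism. ([IUTchI] Def 4.1 (i) p.95) [claim: Mochizuki2012, status: disputed] -/
theorem isIso_of_isClosed [TopologicalSpace A] [IsTopologicalGroup A] [CompactSpace A] [TotallyDisconnectedSpace A]
    {H : Subgroup A} (hH : IsClosed (H : Set A)) (f : (of H : OrbitCat A) ⟶ of H) : IsIso f :=
  isIso_of_conj_le_imp_mem_normalizer (fun a h => mem_normalizer_of_conj_le_of_isClosed hH a h) f

/-- Endomorphisms of an object of a FULL SUBCATEGORY of the orbit category sitting over `ℬ(H)⁰` are automorphisms under the same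
hypothesis (the inclusion is fully faithful). ([IUTchI] Def 4.1 (i) p.95) [claim: Mochizuki2012, status: disputed] -/
theorem isIso_fullSubcategory_of_conj_le_imp_mem_normalizer {P : ObjectProperty (OrbitCat A)} {H : Subgroup A}
    (X : P.FullSubcategory) (hX : X.obj = of H)
    (hN : ∀ a : A, (∀ x ∈ H, a⁻¹ * x * a ∈ H) → a ∈ Subgroup.normalizer (H : Set A))
    (f : X ⟶ X) : IsIso f := by
  obtain ⟨X, hP⟩ := X
  cases hX
  haveI : IsIso (P.ι.map f) := isIso_of_conj_le_imp_mem_normalizer hN f.hom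
  exact P.fullyFaithfulι.isIso_of_isIso_map f

end OrbitCat

/-! ### §3. The genuine Π-avatar kits of the initial Θ-data -/

section GenuineKits

variable {F : Type u} {K : Type v} {Fbar : Type w} [Field F] [NumberField F] [Field K] [NumberField K]
  [Algebra F K] [Field Fbar] [Algebra F Fbar] [Algebra K Fbar]
  {E : WeierstrassCurve F} [E.IsElliptic] {l : ℕ} {Pb : BadPlacePredicates K}
  (D : InitialThetaData F K Fbar E l Pb) (CG : D.geom.pe.CuspGalois) (hS : D.CuspClassesNormaliserStable) [Fact l.Prime]

namespace InitialThetaData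

namespace LocalDatum

variable {D CG hS} (δ : D.LocalDatum CG hS)

/-- **Every endomorphism of the kit model `𝒟_v̲ = ℬ(Π_v̲)⁰` in `Amb v` is an automorphism** as soon as `Π_v̲` is not conjugate to a
proper subgroup of itself (the ambient is a full subcategory of the orbit category of `Π_{C_F}`).
([IUTchI] Def 4.1 (i) p.95) [claim: Mochizuki2012, status: disputed] -/
theorem isIso_endo_model_of_conj_le
    (hN : ∀ a : D.PiC, (∀ x ∈ δ.H, a⁻¹ * x * a ∈ δ.H) → a ∈ Subgroup.normalizer ((δ.H : Subgroup D.PiC) : Set D.PiC))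
    (f : δ.model ⟶ δ.model) : IsIso f :=
  OrbitCat.isIso_fullSubcategory_of_conj_le_imp_mem_normalizer δ.model rfl hN f

/-- The same for a CLOSED local group `Π_v̲ ≤ Π_{C_F}` (profinite). ([IUTchI] Def 4.1 (i) p.95) [claim: Mochizuki2012, status: disputed] -/
theorem isIso_endo_model_of_isClosed (hcl : IsClosed ((δ.H : Subgroup D.PiC) : Set D.PiC))
    (f : δ.model ⟶ δ.model) : IsIso f :=
  δ.isIso_endo_model_of_conj_le (fun a h => OrbitCat.mem_normalizer_of_conj_le_of_isClosed hcl a h) f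

/-- NF-widened ambient `AmbNF` (J-NF-1): the same statement for `modelNF`. ([IUTchI] Def 4.1 (i) p.95) [claim: Mochizuki2012, status: disputed] -/
theorem isIso_endo_modelNF_of_conj_le
    (hN : ∀ a : D.PiC, (∀ x ∈ δ.H, a⁻¹ * x * a ∈ δ.H) → a ∈ Subgroup.normalizer ((δ.H : Subgroup D.PiC) : Set D.PiC))
    (f : δ.modelNF ⟶ δ.modelNF) : IsIso f :=
  OrbitCat.isIso_fullSubcategory_of_conj_le_imp_mem_normalizer δ.modelNF rfl hN f

/-- NF-widened ambient, closed local group. ([IUTchI] Def 4.1 (i) p.95) [claim: Mochizuki2012, status: disputed] -/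
theorem isIso_endo_modelNF_of_isClosed (hcl : IsClosed ((δ.H : Subgroup D.PiC) : Set D.PiC))
    (f : δ.modelNF ⟶ δ.modelNF) : IsIso f :=
  δ.isIso_endo_modelNF_of_conj_le (fun a h => OrbitCat.mem_normalizer_of_conj_le_of_isClosed hcl a h) f

/-- A NON-invertible endomorphism of the kit model exhibits `Π_v̲` conjugate STRICTLY into itself: `a⁻¹ Π_v̲ a ≤ Π_v̲`, `a ∉ N(Π_v̲)`.
([IUTchI] Def 4.1 (i) p.95) [claim: Mochizuki2012, status: disputed] -/
theorem exists_conj_lt_of_not_isIso_model (f : δ.model ⟶ δ.model) (hf : ¬ IsIso f) :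
    ∃ a : D.PiC, (∀ x ∈ δ.H, a⁻¹ * x * a ∈ δ.H) ∧ a ∉ Subgroup.normalizer ((δ.H : Subgroup D.PiC) : Set D.PiC) := by
  by_contra h
  simp only [not_exists, not_and, not_not] at h
  exact hf (δ.isIso_endo_model_of_conj_le h f)

/-- The same for `modelNF`. ([IUTchI] Def 4.1 (i) p.95) [claim: Mochizuki2012, status: disputed] -/
theorem exists_conj_lt_of_not_isIso_modelNF (f : δ.modelNF ⟶ δ.modelNF) (hf : ¬ IsIso f) :
    ∃ a : D.PiC, (∀ x ∈ δ.H, a⁻¹ * x * a ∈ δ.H) ∧ a ∉ Subgroup.normalizer ((δ.H : Subgroup D.PiC) : Set D.PiC) := by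
  by_contra h
  simp only [not_exists, not_and, not_not] at h
  exact hf (δ.isIso_endo_modelNF_of_conj_le h f)

end LocalDatum

/-! #### The kits `baseKitOfData` / `baseKitNFOfData` over an arbitrary index set -/

variable {instN : (D.PiXund.subgroupOf D.PiXK).Normal} (hsurj : Function.Surjective D.toFlStarGlobal)
  {V : Type} {instV : DecidableEq V} (bad arc : Finset V) (δ : V → D.LocalDatum CG hS)

/-- **An evaluation-section binder over the genuine kit forces a bad-index local group conjugate STRICTLY into itself.**
([IUTchI] Ex 4.4 (i) p.106) [claim: Mochizuki2012, status: disputed] -/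
theorem exists_conj_lt_of_evalBinder_baseKitOfData (Eb : (D.baseKitOfData CG hS hsurj bad arc δ).EvalBinder)
    {v : V} (hv : v ∈ bad) :
    ∃ a : D.PiC, (∀ x ∈ (δ v).H, a⁻¹ * x * a ∈ (δ v).H) ∧
      a ∉ Subgroup.normalizer (((δ v).H : Subgroup D.PiC) : Set D.PiC) := by
  obtain ⟨f, hf⟩ := Eb.exists_not_isIso (K := D.baseKitOfData CG hS hsurj bad arc δ) hv
  exact (δ v).exists_conj_lt_of_not_isIso_model f hf

/-- **No `EvalBinder` over `baseKitOfData` if one bad-index local group is not strictly self-conjugate.**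
([IUTchI] Ex 4.4 (i) p.106) [claim: Mochizuki2012, status: disputed] -/
theorem isEmpty_evalBinder_baseKitOfData {v : V} (hv : v ∈ bad)
    (hN : ∀ a : D.PiC, (∀ x ∈ (δ v).H, a⁻¹ * x * a ∈ (δ v).H) →
      a ∈ Subgroup.normalizer (((δ v).H : Subgroup D.PiC) : Set D.PiC)) :
    IsEmpty (D.baseKitOfData CG hS hsurj bad arc δ).EvalBinder :=
  PMBaseKit.isEmpty_evalBinder_of_forall_isIso (K := D.baseKitOfData CG hS hsurj bad arc δ) hv
    ((δ v).isIso_endo_model_of_conj_le hN)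

/-- **No `EvalBinder` over `baseKitOfData` if one bad-index local group is CLOSED in `Π_{C_F}`.**
([IUTchI] Ex 4.4 (i) p.106) [claim: Mochizuki2012, status: disputed] -/
theorem isEmpty_evalBinder_baseKitOfData_of_isClosed {v : V} (hv : v ∈ bad)
    (hcl : IsClosed (((δ v).H : Subgroup D.PiC) : Set D.PiC)) :
    IsEmpty (D.baseKitOfData CG hS hsurj bad arc δ).EvalBinder :=
  PMBaseKit.isEmpty_evalBinder_of_forall_isIso (K := D.baseKitOfData CG hS hsurj bad arc δ) hv
    ((δ v).isIso_endo_model_of_isClosed hcl)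

/-- NF kit: an `EvalBinder` over `baseKitNFOfData` forces a strictly self-conjugate bad-index local group.
([IUTchI] Ex 4.4 (i) p.106) [claim: Mochizuki2012, status: disputed] -/
theorem exists_conj_lt_of_evalBinder_baseKitNFOfData (Eb : (D.baseKitNFOfData CG hS hsurj bad arc δ).EvalBinder)
    {v : V} (hv : v ∈ bad) :
    ∃ a : D.PiC, (∀ x ∈ (δ v).H, a⁻¹ * x * a ∈ (δ v).H) ∧
      a ∉ Subgroup.normalizer (((δ v).H : Subgroup D.PiC) : Set D.PiC) := by
  obtain ⟨f, hf⟩ := Eb.exists_not_isIso (K := D.baseKitNFOfData CG hS hsurj bad arc δ) hv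
  exact (δ v).exists_conj_lt_of_not_isIso_modelNF f hf

/-- NF kit: no `EvalBinder` if one bad-index local group is not strictly self-conjugate.
([IUTchI] Ex 4.4 (i) p.106) [claim: Mochizuki2012, status: disputed] -/
theorem isEmpty_evalBinder_baseKitNFOfData {v : V} (hv : v ∈ bad)
    (hN : ∀ a : D.PiC, (∀ x ∈ (δ v).H, a⁻¹ * x * a ∈ (δ v).H) →
      a ∈ Subgroup.normalizer (((δ v).H : Subgroup D.PiC) : Set D.PiC)) :
    IsEmpty (D.baseKitNFOfData CG hS hsurj bad arc δ).EvalBinder :=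
  PMBaseKit.isEmpty_evalBinder_of_forall_isIso (K := D.baseKitNFOfData CG hS hsurj bad arc δ) hv
    ((δ v).isIso_endo_modelNF_of_conj_le hN)

/-- NF kit: no `EvalBinder` if one bad-index local group is closed. ([IUTchI] Ex 4.4 (i) p.106) [claim: Mochizuki2012, status: disputed] -/
theorem isEmpty_evalBinder_baseKitNFOfData_of_isClosed {v : V} (hv : v ∈ bad)
    (hcl : IsClosed (((δ v).H : Subgroup D.PiC) : Set D.PiC)) :
    IsEmpty (D.baseKitNFOfData CG hS hsurj bad arc δ).EvalBinder :=
  PMBaseKit.isEmpty_evalBinder_of_forall_isIso (K := D.baseKitNFOfData CG hS hsurj bad arc δ) hv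
    ((δ v).isIso_endo_modelNF_of_isClosed hcl)


/-! #### Core agreements `KitCore 𝔡 K₀` with an ARBITRARY §4 datum `𝔡` (the kit's prime read as `𝔡.l`) -/

end InitialThetaData

section KitCoreAtGenuine

variable (𝔡 : BaseThetaDatum.{w}) (D' : InitialThetaData F K Fbar E 𝔡.l Pb) (CG' : D'.geom.pe.CuspGalois)
  (hS' : D'.CuspClassesNormaliserStable) {instN : (D'.PiXund.subgroupOf D'.PiXK).Normal}
  (hsurj : Function.Surjective D'.toFlStarGlobal) {V : Type} {instV : DecidableEq V} (bad arc : Finset V)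
  (δ : V → D'.LocalDatum CG' hS')

/-- **A core agreement of the genuine kit with ANY §4 datum forces a bad-index local group conjugate STRICTLY into itself** (law (γ)
`KitCore.ThetaAgrees` presupposes such a `KitCore`). ([IUTchI] Prop 6.7 p.167) [claim: Mochizuki2012, status: disputed] -/
theorem InitialThetaData.exists_conj_lt_of_kitCore_baseKitOfData (c : 𝔡.KitCore (D'.baseKitOfData CG' hS' hsurj bad arc δ))
    {v : V} (hv : v ∈ bad) :
    ∃ a : D'.PiC, (∀ x ∈ (δ v).H, a⁻¹ * x * a ∈ (δ v).H) ∧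
      a ∉ Subgroup.normalizer (((δ v).H : Subgroup D'.PiC) : Set D'.PiC) := by
  obtain ⟨f, hf⟩ := c.exists_endo_not_isIso (K := D'.baseKitOfData CG' hS' hsurj bad arc δ) hv
  exact (δ v).exists_conj_lt_of_not_isIso_model f hf

/-- **NO core agreement `KitCore 𝔡 (baseKitOfData …)` with ANY §4 datum if one bad-index local group is closed in `Π_{C_F}`** — so
law (γ) has no instance over the genuine Θ-side kit as designed (D1 EMBEDDED). ([IUTchI] Prop 6.7 p.167) [claim: Mochizuki2012, status: disputed] -/
theorem InitialThetaData.isEmpty_kitCore_baseKitOfData_of_isClosed {v : V} (hv : v ∈ bad)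
    (hcl : IsClosed (((δ v).H : Subgroup D'.PiC) : Set D'.PiC)) :
    IsEmpty (𝔡.KitCore (D'.baseKitOfData CG' hS' hsurj bad arc δ)) :=
  𝔡.isEmpty_kitCore_of_forall_isIso (D'.baseKitOfData CG' hS' hsurj bad arc δ) hv ((δ v).isIso_endo_model_of_isClosed hcl)

/-- NF kit: a core agreement forces a strictly self-conjugate bad-index local group. ([IUTchI] Prop 6.7 p.167) [claim: Mochizuki2012, status: disputed] -/
theorem InitialThetaData.exists_conj_lt_of_kitCore_baseKitNFOfData (c : 𝔡.KitCore (D'.baseKitNFOfData CG' hS' hsurj bad arc δ))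
    {v : V} (hv : v ∈ bad) :
    ∃ a : D'.PiC, (∀ x ∈ (δ v).H, a⁻¹ * x * a ∈ (δ v).H) ∧
      a ∉ Subgroup.normalizer (((δ v).H : Subgroup D'.PiC) : Set D'.PiC) := by
  obtain ⟨f, hf⟩ := c.exists_endo_not_isIso (K := D'.baseKitNFOfData CG' hS' hsurj bad arc δ) hv
  exact (δ v).exists_conj_lt_of_not_isIso_modelNF f hf

/-- **NF kit (J-NF-1): NO core agreement with ANY §4 datum if one bad-index local group is closed** — the kit of abc-iut-L5-t3's
`kitCoreStandIn` (p452433) is of this form. ([IUTchI] Prop 6.7 p.167) [claim: Mochizuki2012, status: disputed] -/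
theorem InitialThetaData.isEmpty_kitCore_baseKitNFOfData_of_isClosed {v : V} (hv : v ∈ bad)
    (hcl : IsClosed (((δ v).H : Subgroup D'.PiC) : Set D'.PiC)) :
    IsEmpty (𝔡.KitCore (D'.baseKitNFOfData CG' hS' hsurj bad arc δ)) :=
  𝔡.isEmpty_kitCore_of_forall_isIso (D'.baseKitNFOfData CG' hS' hsurj bad arc δ) hv ((δ v).isIso_endo_modelNF_of_isClosed hcl)

end KitCoreAtGenuine

end GenuineKits

end Literature.IUT.HodgeTheaters
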